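import Mathlib
import HarnessLib

/-!
# `NoHeavyLowerTail` (crux stmt-CriticalPhenomena-4575), antithetic vdBHK programme: L-PURE for BROOMS (THEOREM Q)

Support file (seat `prim-ineq-gen-7` gen 29; `--supports stmt-CriticalPhenomena-4575`).  Nothing is asserted about the crux; no `sorry`,
no definitions.  Memo: run/shared/lean/prim/prim-ineq-gen-7/FINDING-PURE-g29.md §3b.

CONTEXT.  For the broom `f + r leaves` rooted at the free end of `f`, the colouring poset `F_v` is `Bot ⊔ Top` (two antichains indexed by
the red leaf set `γ ∈ Ω = 2^{[r]}`, every bottom below every top); an up-set is a pair (bottom part `S°`, top part `S`) of subsets of `Ω`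
with `S° ≠ ∅ ⟹ S = Ω`; `Φ(R,γ) = (B,γᶜ)`, `Φ(B,γ) = (R,γ)`, `K((B,γ)) = {(R,γ′) : γ′ ⊆ γ}`.  The localized pure inequality L-PURE of the
memo (§0–§2; it implies the per-tree inequality `(***)`) is for the broom the counting inequality `#{deficit tops} ≤ Σ_γ q(R,γ)` (a down-set
containing a top contains every bottom), with the bottom value
`q(R,γ) = (1_{A°}−1_{A′°})(1_{B°}−1_{B′°})(γ) + [γᶜ∈A, γ∉A′°, γ∉B°, γᶜ∈B′ ∨ γᶜ∈A′, γ∉A°, γᶜ∈B, γ∉B′°]`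
and a top `(B,γ)` in deficit iff `(1_A−1_{A′})(1_B−1_{B′})(γ) + [γ∈↑A°, γ∉A′, γ∉B, γ∈↑B′° ∨ mirror] < 0`.
`broom_lpure` proves it for an ARBITRARY finite index type, any involution `bar` in place of `γ ↦ γᶜ`, and any supersets `UA ⊇ A°, …` in
place of the up-closures (only `X° ⊆ ↑X°` is used), by the phase analysis of the memo: two nonempty bottom parts on the same side or the
same letter ⟹ no deficits; the 'diagonal' phases `(A°,B′°)`, `(A′°,B°)` pointwise; at most one nonempty bottom part ⟹ reindex the payers by
`bar`.  The finite pointwise facts are `decide`d over at most twelve Booleans.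

* `AntitheticPureBroom.broom_lpure` — THEOREM Q. [this work]
-/

namespace Summit.CriticalPhenomena.PercolationContinuityZ3.Theorems

open Finset

namespace AntitheticPureBroom

set_option synthInstance.maxSize 100000 in
/-- Bottom values are nonnegative (a bottom in `A°∩B′°∖(A′°∪B°)` forces `A = B′ = Ω`, hence its certificate). -/
private theorem botA : ∀ (a0 a0' b0 b0' xa xa' xb xb' : Bool),
    (a0 = true → xa = true) → (a0' = true → xa' = true) → (b0 = true → xb = true) → (b0' = true → xb' = true) →
    0 ≤ (((if a0 then (1:ℤ) else 0) - (if a0' then (1:ℤ) else 0)) * ((if b0 then (1:ℤ) else 0) - (if b0' then (1:ℤ) else 0))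
        + (if ((xa ∧ ¬ a0' ∧ ¬ b0 ∧ xb') ∨ (xa' ∧ ¬ a0 ∧ xb ∧ ¬ b0')) then (1:ℤ) else 0)) := by
  decide

set_option synthInstance.maxSize 100000 in
/-- Phases with `A = A′ = Ω`, or `B = B′ = Ω`, or `A = B = Ω`, or `A′ = B′ = Ω`: no top is in deficit. -/
private theorem topB : ∀ (a a' b b' ua ua' ub ub' PA PA' PB PB' : Bool),
    (PA = true → a = true) → (PA' = true → a' = true) → (PB = true → b = true) → (PB' = true → b' = true) →
    ((PA = true ∧ PA' = true) ∨ (PB = true ∧ PB' = true) ∨ (PA = true ∧ PB = true) ∨ (PA' = true ∧ PB' = true)) →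
    (if (((if a then (1:ℤ) else 0) - (if a' then (1:ℤ) else 0)) * ((if b then (1:ℤ) else 0) - (if b' then (1:ℤ) else 0))
        + (if ((ua ∧ ¬ a' ∧ ¬ b ∧ ub') ∨ (ua' ∧ ¬ a ∧ ub ∧ ¬ b')) then (1:ℤ) else 0)) < 0 then (1:ℤ) else 0) ≤ 0 := by
  decide

set_option synthInstance.maxSize 100000 in
/-- Diagonal phase `(A°,B′°)` (`A = B′ = Ω`, `A′° = B° = ∅`), bottoms: `q(R,γ) ≥ 1 − [γ ∈ A°∩B′°]`. -/
private theorem botC1 : ∀ (a0 a0' b0 b0' xa xa' xb xb' : Bool),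
    xa = true → xb' = true → a0' = false → b0 = false →
    1 ≤ (((if a0 then (1:ℤ) else 0) - (if a0' then (1:ℤ) else 0)) * ((if b0 then (1:ℤ) else 0) - (if b0' then (1:ℤ) else 0))
        + (if ((xa ∧ ¬ a0' ∧ ¬ b0 ∧ xb') ∨ (xa' ∧ ¬ a0 ∧ xb ∧ ¬ b0')) then (1:ℤ) else 0))
        + (if (a0 ∧ b0') then (1:ℤ) else 0) := by
  decide

set_option synthInstance.maxSize 100000 in
/-- Diagonal phase `(A°,B′°)`, tops: a deficit top lies outside `UA ∩ UB′` (`A = B′ = Ω`). -/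
private theorem topC2 : ∀ (a a' b b' ua ua' ub ub' : Bool),
    a = true → b' = true →
    (if (((if a then (1:ℤ) else 0) - (if a' then (1:ℤ) else 0)) * ((if b then (1:ℤ) else 0) - (if b' then (1:ℤ) else 0))
        + (if ((ua ∧ ¬ a' ∧ ¬ b ∧ ub') ∨ (ua' ∧ ¬ a ∧ ub ∧ ¬ b')) then (1:ℤ) else 0)) < 0 then (1:ℤ) else 0)
        + (if (ua ∧ ub') then (1:ℤ) else 0) ≤ 1 := by
  decide

set_option synthInstance.maxSize 100000 in
/-- Mirror diagonal phase `(A′°,B°)`, bottoms. -/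
private theorem botC1' : ∀ (a0 a0' b0 b0' xa xa' xb xb' : Bool),
    xa' = true → xb = true → a0 = false → b0' = false →
    1 ≤ (((if a0 then (1:ℤ) else 0) - (if a0' then (1:ℤ) else 0)) * ((if b0 then (1:ℤ) else 0) - (if b0' then (1:ℤ) else 0))
        + (if ((xa ∧ ¬ a0' ∧ ¬ b0 ∧ xb') ∨ (xa' ∧ ¬ a0 ∧ xb ∧ ¬ b0')) then (1:ℤ) else 0))
        + (if (a0' ∧ b0) then (1:ℤ) else 0) := by
  decide

set_option synthInstance.maxSize 100000 in
/-- Mirror diagonal phase `(A′°,B°)`, tops. -/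
private theorem topC2' : ∀ (a a' b b' ua ua' ub ub' : Bool),
    a' = true → b = true →
    (if (((if a then (1:ℤ) else 0) - (if a' then (1:ℤ) else 0)) * ((if b then (1:ℤ) else 0) - (if b' then (1:ℤ) else 0))
        + (if ((ua ∧ ¬ a' ∧ ¬ b ∧ ub') ∨ (ua' ∧ ¬ a ∧ ub ∧ ¬ b')) then (1:ℤ) else 0)) < 0 then (1:ℤ) else 0)
        + (if (ua' ∧ ub) then (1:ℤ) else 0) ≤ 1 := by
  decide

set_option synthInstance.maxSize 100000 in
/-- Reindexing phases (at most one nonempty bottom part), payer side: `q(R,γ) ≥ [γᶜ ∈ C]` for the phase's payer set `C`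
(`(A∩B′)∪(A′∩B)`, `B′`, `A`, `B`, `A′`). -/
private theorem schemeBot : ∀ (a0 a0' b0 b0' xa xa' xb xb' PA PA' PB PB' : Bool),
    (a0 = true → PA = true) → (a0' = true → PA' = true) → (b0 = true → PB = true) → (b0' = true → PB' = true) →
    (PA = true → xa = true) → (PA' = true → xa' = true) → (PB = true → xb = true) → (PB' = true → xb' = true) →
    (¬ (PA = true ∧ PA' = true)) → (¬ (PB = true ∧ PB' = true)) → (¬ (PA = true ∧ PB = true)) → (¬ (PA' = true ∧ PB' = true)) →
    (¬ (PA = true ∧ PB' = true)) → (¬ (PA' = true ∧ PB = true)) →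
    (if ((PA = false ∧ PA' = false ∧ PB = false ∧ PB' = false ∧ ((xa ∧ xb') ∨ (xa' ∧ xb))) ∨ (PA = true ∧ xb') ∨ (PB' = true ∧ xa) ∨ (PA' = true ∧ xb) ∨ (PB = true ∧ xa')) then (1:ℤ) else 0)
      ≤ (((if a0 then (1:ℤ) else 0) - (if a0' then (1:ℤ) else 0)) * ((if b0 then (1:ℤ) else 0) - (if b0' then (1:ℤ) else 0))
        + (if ((xa ∧ ¬ a0' ∧ ¬ b0 ∧ xb') ∨ (xa' ∧ ¬ a0 ∧ xb ∧ ¬ b0')) then (1:ℤ) else 0)) := by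
  decide

set_option synthInstance.maxSize 100000 in
/-- Reindexing phases, deficit side: a deficit top lies in the phase's payer set `C`. -/
private theorem schemeTop : ∀ (a a' b b' ua ua' ub ub' PA PA' PB PB' : Bool),
    (PA = true → a = true) → (PA' = true → a' = true) → (PB = true → b = true) → (PB' = true → b' = true) →
    (if (((if a then (1:ℤ) else 0) - (if a' then (1:ℤ) else 0)) * ((if b then (1:ℤ) else 0) - (if b' then (1:ℤ) else 0))
        + (if ((ua ∧ ¬ a' ∧ ¬ b ∧ ub') ∨ (ua' ∧ ¬ a ∧ ub ∧ ¬ b')) then (1:ℤ) else 0)) < 0 then (1:ℤ) else 0)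
      ≤ (if ((PA = false ∧ PA' = false ∧ PB = false ∧ PB' = false ∧ ((a ∧ b') ∨ (a' ∧ b))) ∨ (PA = true ∧ b') ∨ (PB' = true ∧ a) ∨ (PA' = true ∧ b) ∨ (PB = true ∧ a')) then (1:ℤ) else 0) := by
  decide

variable {α : Type*} [Fintype α] [DecidableEq α]

/-- **THEOREM Q (L-PURE for brooms, abstract form).**  `α` any finite index type (the red-leaf sets), `bar` any involution (the
complement), bottom parts `A0, A0', B0, B0'`, top parts `A, A', B, B'` with `X0 ≠ ∅ ⟹ X = univ` (the up-set condition of the broom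
poset), and any `UA ⊇ A0, UA' ⊇ A0', UB ⊇ B0, UB' ⊇ B0'` (the up-closures in the top certificates).  Then
`0 ≤ Σ_γ (q(R,γ) − [top γ in deficit])`, i.e. the number of deficit tops is at most the total bottom value. [this work] -/
theorem broom_lpure (bar : α → α) (hbar : Function.Involutive bar)
    (A0 A0' B0 B0' A A' B B' UA UA' UB UB' : Finset α)
    (hA : A0.Nonempty → A = univ) (hA' : A0'.Nonempty → A' = univ) (hB : B0.Nonempty → B = univ) (hB' : B0'.Nonempty → B' = univ)
    (hUA : A0 ⊆ UA) (hUA' : A0' ⊆ UA') (hUB : B0 ⊆ UB) (hUB' : B0' ⊆ UB') :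
    0 ≤ ∑ γ : α,
        ((((if γ ∈ A0 then (1:ℤ) else 0) - (if γ ∈ A0' then (1:ℤ) else 0)) * ((if γ ∈ B0 then (1:ℤ) else 0) - (if γ ∈ B0' then (1:ℤ) else 0))
            + (if ((bar γ ∈ A ∧ γ ∉ A0' ∧ γ ∉ B0 ∧ bar γ ∈ B') ∨ (bar γ ∈ A' ∧ γ ∉ A0 ∧ bar γ ∈ B ∧ γ ∉ B0')) then (1:ℤ) else 0))
          - (if (((if γ ∈ A then (1:ℤ) else 0) - (if γ ∈ A' then (1:ℤ) else 0)) * ((if γ ∈ B then (1:ℤ) else 0) - (if γ ∈ B' then (1:ℤ) else 0))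
            + (if ((γ ∈ UA ∧ γ ∉ A' ∧ γ ∉ B ∧ γ ∈ UB') ∨ (γ ∈ UA' ∧ γ ∉ A ∧ γ ∈ UB ∧ γ ∉ B')) then (1:ℤ) else 0)) < 0 then (1:ℤ) else 0)) := by
  set PA : Bool := decide A0.Nonempty with hPAdef
  set PA' : Bool := decide A0'.Nonempty with hPA'def
  set PB : Bool := decide B0.Nonempty with hPBdef
  set PB' : Bool := decide B0'.Nonempty with hPB'def
  have fA0 : ∀ γ, decide (γ ∈ A0) = true → PA = true := fun γ h => by
    rw [hPAdef, decide_eq_true_eq]; exact ⟨γ, by simpa using h⟩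
  have fA0' : ∀ γ, decide (γ ∈ A0') = true → PA' = true := fun γ h => by
    rw [hPA'def, decide_eq_true_eq]; exact ⟨γ, by simpa using h⟩
  have fB0 : ∀ γ, decide (γ ∈ B0) = true → PB = true := fun γ h => by
    rw [hPBdef, decide_eq_true_eq]; exact ⟨γ, by simpa using h⟩
  have fB0' : ∀ γ, decide (γ ∈ B0') = true → PB' = true := fun γ h => by
    rw [hPB'def, decide_eq_true_eq]; exact ⟨γ, by simpa using h⟩
  have gA : ∀ δ, PA = true → decide (δ ∈ A) = true := fun δ h => by
    rw [hPAdef, decide_eq_true_eq] at h; simp [hA h]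
  have gA' : ∀ δ, PA' = true → decide (δ ∈ A') = true := fun δ h => by
    rw [hPA'def, decide_eq_true_eq] at h; simp [hA' h]
  have gB : ∀ δ, PB = true → decide (δ ∈ B) = true := fun δ h => by
    rw [hPBdef, decide_eq_true_eq] at h; simp [hB h]
  have gB' : ∀ δ, PB' = true → decide (δ ∈ B') = true := fun δ h => by
    rw [hPB'def, decide_eq_true_eq] at h; simp [hB' h]
  have uA : ∀ γ, decide (γ ∈ A0) = true → decide (γ ∈ UA) = true := fun γ h => by simpa using hUA (by simpa using h)
  have uA' : ∀ γ, decide (γ ∈ A0') = true → decide (γ ∈ UA') = true := fun γ h => by simpa using hUA' (by simpa using h)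
  have uB : ∀ γ, decide (γ ∈ B0) = true → decide (γ ∈ UB) = true := fun γ h => by simpa using hUB (by simpa using h)
  have uB' : ∀ γ, decide (γ ∈ B0') = true → decide (γ ∈ UB') = true := fun γ h => by simpa using hUB' (by simpa using h)
  -- bottoms are nonnegative everywhere
  have hbot0 : ∀ γ, 0 ≤ (((if γ ∈ A0 then (1:ℤ) else 0) - (if γ ∈ A0' then (1:ℤ) else 0)) * ((if γ ∈ B0 then (1:ℤ) else 0) - (if γ ∈ B0' then (1:ℤ) else 0))
            + (if ((bar γ ∈ A ∧ γ ∉ A0' ∧ γ ∉ B0 ∧ bar γ ∈ B') ∨ (bar γ ∈ A' ∧ γ ∉ A0 ∧ bar γ ∈ B ∧ γ ∉ B0')) then (1:ℤ) else 0)) := by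
    intro γ
    have key := botA (decide (γ ∈ A0)) (decide (γ ∈ A0')) (decide (γ ∈ B0)) (decide (γ ∈ B0'))
      (decide (bar γ ∈ A)) (decide (bar γ ∈ A')) (decide (bar γ ∈ B)) (decide (bar γ ∈ B'))
      (fun h => gA (bar γ) (fA0 γ h)) (fun h => gA' (bar γ) (fA0' γ h)) (fun h => gB (bar γ) (fB0 γ h)) (fun h => gB' (bar γ) (fB0' γ h))
    simpa only [decide_eq_true_eq, Bool.decide_and, Bool.decide_or, decide_not] using key
  by_cases hI : (PA = true ∧ PA' = true) ∨ (PB = true ∧ PB' = true) ∨ (PA = true ∧ PB = true) ∨ (PA' = true ∧ PB' = true)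
  · refine Finset.sum_nonneg (fun γ _ => ?_)
    have key := topB (decide (γ ∈ A)) (decide (γ ∈ A')) (decide (γ ∈ B)) (decide (γ ∈ B'))
      (decide (γ ∈ UA)) (decide (γ ∈ UA')) (decide (γ ∈ UB)) (decide (γ ∈ UB')) PA PA' PB PB' (gA γ) (gA' γ) (gB γ) (gB' γ) hI
    have ht : (if (((if γ ∈ A then (1:ℤ) else 0) - (if γ ∈ A' then (1:ℤ) else 0)) * ((if γ ∈ B then (1:ℤ) else 0) - (if γ ∈ B' then (1:ℤ) else 0))
            + (if ((γ ∈ UA ∧ γ ∉ A' ∧ γ ∉ B ∧ γ ∈ UB') ∨ (γ ∈ UA' ∧ γ ∉ A ∧ γ ∈ UB ∧ γ ∉ B')) then (1:ℤ) else 0)) < 0 then (1:ℤ) else 0) ≤ 0 := by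
      simpa only [decide_eq_true_eq, Bool.decide_and, Bool.decide_or, decide_not] using key
    linarith [hbot0 γ, ht]
  by_cases hII : PA = true ∧ PB' = true
  · have hPA'f : PA' = false := by
      cases h : PA' with
      | false => rfl
      | true => exact absurd (Or.inl ⟨hII.1, h⟩) hI
    have hPBf : PB = false := by
      cases h : PB with
      | false => rfl
      | true => exact absurd (Or.inr (Or.inr (Or.inl ⟨hII.1, h⟩))) hI
    refine Finset.sum_nonneg (fun γ _ => ?_)
    have xa : decide (bar γ ∈ A) = true := gA (bar γ) hII.1
    have xb' : decide (bar γ ∈ B') = true := gB' (bar γ) hII.2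
    have na0' : decide (γ ∈ A0') = false := by
      cases h : decide (γ ∈ A0') with
      | false => rfl
      | true => exact absurd (fA0' γ h) (by simp [hPA'f])
    have nb0 : decide (γ ∈ B0) = false := by
      cases h : decide (γ ∈ B0) with
      | false => rfl
      | true => exact absurd (fB0 γ h) (by simp [hPBf])
    have k1 := botC1 (decide (γ ∈ A0)) (decide (γ ∈ A0')) (decide (γ ∈ B0)) (decide (γ ∈ B0'))
      (decide (bar γ ∈ A)) (decide (bar γ ∈ A')) (decide (bar γ ∈ B)) (decide (bar γ ∈ B')) xa xb' na0' nb0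
    have k2 := topC2 (decide (γ ∈ A)) (decide (γ ∈ A')) (decide (γ ∈ B)) (decide (γ ∈ B'))
      (decide (γ ∈ UA)) (decide (γ ∈ UA')) (decide (γ ∈ UB)) (decide (γ ∈ UB')) (gA γ hII.1) (gB' γ hII.2)
    have e1 : 1 ≤ (((if γ ∈ A0 then (1:ℤ) else 0) - (if γ ∈ A0' then (1:ℤ) else 0)) * ((if γ ∈ B0 then (1:ℤ) else 0) - (if γ ∈ B0' then (1:ℤ) else 0))
            + (if ((bar γ ∈ A ∧ γ ∉ A0' ∧ γ ∉ B0 ∧ bar γ ∈ B') ∨ (bar γ ∈ A' ∧ γ ∉ A0 ∧ bar γ ∈ B ∧ γ ∉ B0')) then (1:ℤ) else 0))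
        + (if (γ ∈ A0 ∧ γ ∈ B0') then (1:ℤ) else 0) := by
      simpa only [decide_eq_true_eq, Bool.decide_and, Bool.decide_or, decide_not] using k1
    have e2 : (if (((if γ ∈ A then (1:ℤ) else 0) - (if γ ∈ A' then (1:ℤ) else 0)) * ((if γ ∈ B then (1:ℤ) else 0) - (if γ ∈ B' then (1:ℤ) else 0))
            + (if ((γ ∈ UA ∧ γ ∉ A' ∧ γ ∉ B ∧ γ ∈ UB') ∨ (γ ∈ UA' ∧ γ ∉ A ∧ γ ∈ UB ∧ γ ∉ B')) then (1:ℤ) else 0)) < 0 then (1:ℤ) else 0)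
        + (if (γ ∈ UA ∧ γ ∈ UB') then (1:ℤ) else 0) ≤ 1 := by
      simpa only [decide_eq_true_eq, Bool.decide_and, Bool.decide_or, decide_not] using k2
    have e3 : (if (γ ∈ A0 ∧ γ ∈ B0') then (1:ℤ) else 0) ≤ (if (γ ∈ UA ∧ γ ∈ UB') then (1:ℤ) else 0) := by
      by_cases h : γ ∈ A0 ∧ γ ∈ B0'
      · have h' : γ ∈ UA ∧ γ ∈ UB' := ⟨hUA h.1, hUB' h.2⟩
        simp [h, h']
      · by_cases h' : γ ∈ UA ∧ γ ∈ UB' <;> simp [h, h']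
    linarith
  by_cases hII' : PA' = true ∧ PB = true
  · have hPAf : PA = false := by
      cases h : PA with
      | false => rfl
      | true => exact absurd (Or.inl ⟨h, hII'.1⟩) hI
    have hPB'f : PB' = false := by
      cases h : PB' with
      | false => rfl
      | true => exact absurd (Or.inr (Or.inl ⟨hII'.2, h⟩)) hI
    refine Finset.sum_nonneg (fun γ _ => ?_)
    have xa' : decide (bar γ ∈ A') = true := gA' (bar γ) hII'.1
    have xb : decide (bar γ ∈ B) = true := gB (bar γ) hII'.2
    have na0 : decide (γ ∈ A0) = false := by
      cases h : decide (γ ∈ A0) with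
      | false => rfl
      | true => exact absurd (fA0 γ h) (by simp [hPAf])
    have nb0' : decide (γ ∈ B0') = false := by
      cases h : decide (γ ∈ B0') with
      | false => rfl
      | true => exact absurd (fB0' γ h) (by simp [hPB'f])
    have k1 := botC1' (decide (γ ∈ A0)) (decide (γ ∈ A0')) (decide (γ ∈ B0)) (decide (γ ∈ B0'))
      (decide (bar γ ∈ A)) (decide (bar γ ∈ A')) (decide (bar γ ∈ B)) (decide (bar γ ∈ B')) xa' xb na0 nb0'
    have k2 := topC2' (decide (γ ∈ A)) (decide (γ ∈ A')) (decide (γ ∈ B)) (decide (γ ∈ B'))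
      (decide (γ ∈ UA)) (decide (γ ∈ UA')) (decide (γ ∈ UB)) (decide (γ ∈ UB')) (gA' γ hII'.1) (gB γ hII'.2)
    have e1 : 1 ≤ (((if γ ∈ A0 then (1:ℤ) else 0) - (if γ ∈ A0' then (1:ℤ) else 0)) * ((if γ ∈ B0 then (1:ℤ) else 0) - (if γ ∈ B0' then (1:ℤ) else 0))
            + (if ((bar γ ∈ A ∧ γ ∉ A0' ∧ γ ∉ B0 ∧ bar γ ∈ B') ∨ (bar γ ∈ A' ∧ γ ∉ A0 ∧ bar γ ∈ B ∧ γ ∉ B0')) then (1:ℤ) else 0))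
        + (if (γ ∈ A0' ∧ γ ∈ B0) then (1:ℤ) else 0) := by
      simpa only [decide_eq_true_eq, Bool.decide_and, Bool.decide_or, decide_not] using k1
    have e2 : (if (((if γ ∈ A then (1:ℤ) else 0) - (if γ ∈ A' then (1:ℤ) else 0)) * ((if γ ∈ B then (1:ℤ) else 0) - (if γ ∈ B' then (1:ℤ) else 0))
            + (if ((γ ∈ UA ∧ γ ∉ A' ∧ γ ∉ B ∧ γ ∈ UB') ∨ (γ ∈ UA' ∧ γ ∉ A ∧ γ ∈ UB ∧ γ ∉ B')) then (1:ℤ) else 0)) < 0 then (1:ℤ) else 0)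
        + (if (γ ∈ UA' ∧ γ ∈ UB) then (1:ℤ) else 0) ≤ 1 := by
      simpa only [decide_eq_true_eq, Bool.decide_and, Bool.decide_or, decide_not] using k2
    have e3 : (if (γ ∈ A0' ∧ γ ∈ B0) then (1:ℤ) else 0) ≤ (if (γ ∈ UA' ∧ γ ∈ UB) then (1:ℤ) else 0) := by
      by_cases h : γ ∈ A0' ∧ γ ∈ B0
      · have h' : γ ∈ UA' ∧ γ ∈ UB := ⟨hUA' h.1, hUB h.2⟩
        simp [h, h']
      · by_cases h' : γ ∈ UA' ∧ γ ∈ UB <;> simp [h, h']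
    linarith
  -- reindexing phases: at most one nonempty bottom part
  have nd1 : ¬ (PA = true ∧ PA' = true) := fun h => hI (Or.inl h)
  have nd2 : ¬ (PB = true ∧ PB' = true) := fun h => hI (Or.inr (Or.inl h))
  have nd3 : ¬ (PA = true ∧ PB = true) := fun h => hI (Or.inr (Or.inr (Or.inl h)))
  have nd4 : ¬ (PA' = true ∧ PB' = true) := fun h => hI (Or.inr (Or.inr (Or.inr h)))
  have hbot : ∀ γ, (if ((PA = false ∧ PA' = false ∧ PB = false ∧ PB' = false ∧ ((bar γ ∈ A ∧ bar γ ∈ B') ∨ (bar γ ∈ A' ∧ bar γ ∈ B))) ∨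
          (PA = true ∧ bar γ ∈ B') ∨ (PB' = true ∧ bar γ ∈ A) ∨ (PA' = true ∧ bar γ ∈ B) ∨ (PB = true ∧ bar γ ∈ A')) then (1:ℤ) else 0)
      ≤ (((if γ ∈ A0 then (1:ℤ) else 0) - (if γ ∈ A0' then (1:ℤ) else 0)) * ((if γ ∈ B0 then (1:ℤ) else 0) - (if γ ∈ B0' then (1:ℤ) else 0))
            + (if ((bar γ ∈ A ∧ γ ∉ A0' ∧ γ ∉ B0 ∧ bar γ ∈ B') ∨ (bar γ ∈ A' ∧ γ ∉ A0 ∧ bar γ ∈ B ∧ γ ∉ B0')) then (1:ℤ) else 0)) := by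
    intro γ
    have key := schemeBot (decide (γ ∈ A0)) (decide (γ ∈ A0')) (decide (γ ∈ B0)) (decide (γ ∈ B0'))
      (decide (bar γ ∈ A)) (decide (bar γ ∈ A')) (decide (bar γ ∈ B)) (decide (bar γ ∈ B')) PA PA' PB PB'
      (fA0 γ) (fA0' γ) (fB0 γ) (fB0' γ) (gA (bar γ)) (gA' (bar γ)) (gB (bar γ)) (gB' (bar γ))
      nd1 nd2 nd3 nd4 hII hII'
    simpa only [decide_eq_true_eq, Bool.decide_and, Bool.decide_or, decide_not, decide_eq_false_iff_not] using key
  have htop : ∀ γ, (if (((if γ ∈ A then (1:ℤ) else 0) - (if γ ∈ A' then (1:ℤ) else 0)) * ((if γ ∈ B then (1:ℤ) else 0) - (if γ ∈ B' then (1:ℤ) else 0))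
            + (if ((γ ∈ UA ∧ γ ∉ A' ∧ γ ∉ B ∧ γ ∈ UB') ∨ (γ ∈ UA' ∧ γ ∉ A ∧ γ ∈ UB ∧ γ ∉ B')) then (1:ℤ) else 0)) < 0 then (1:ℤ) else 0)
      ≤ (if ((PA = false ∧ PA' = false ∧ PB = false ∧ PB' = false ∧ ((γ ∈ A ∧ γ ∈ B') ∨ (γ ∈ A' ∧ γ ∈ B))) ∨
          (PA = true ∧ γ ∈ B') ∨ (PB' = true ∧ γ ∈ A) ∨ (PA' = true ∧ γ ∈ B) ∨ (PB = true ∧ γ ∈ A')) then (1:ℤ) else 0) := by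
    intro γ
    have key := schemeTop (decide (γ ∈ A)) (decide (γ ∈ A')) (decide (γ ∈ B)) (decide (γ ∈ B'))
      (decide (γ ∈ UA)) (decide (γ ∈ UA')) (decide (γ ∈ UB)) (decide (γ ∈ UB')) PA PA' PB PB' (gA γ) (gA' γ) (gB γ) (gB' γ)
    simpa only [decide_eq_true_eq, Bool.decide_and, Bool.decide_or, decide_not, decide_eq_false_iff_not] using key
  have hre : ∑ γ : α, (if ((PA = false ∧ PA' = false ∧ PB = false ∧ PB' = false ∧ ((bar γ ∈ A ∧ bar γ ∈ B') ∨ (bar γ ∈ A' ∧ bar γ ∈ B))) ∨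
          (PA = true ∧ bar γ ∈ B') ∨ (PB' = true ∧ bar γ ∈ A) ∨ (PA' = true ∧ bar γ ∈ B) ∨ (PB = true ∧ bar γ ∈ A')) then (1:ℤ) else 0)
      = ∑ γ : α, (if ((PA = false ∧ PA' = false ∧ PB = false ∧ PB' = false ∧ ((γ ∈ A ∧ γ ∈ B') ∨ (γ ∈ A' ∧ γ ∈ B))) ∨
          (PA = true ∧ γ ∈ B') ∨ (PB' = true ∧ γ ∈ A) ∨ (PA' = true ∧ γ ∈ B) ∨ (PB = true ∧ γ ∈ A')) then (1:ℤ) else 0) :=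
    Equiv.sum_comp (Function.Involutive.toPerm bar hbar) (fun δ => (if ((PA = false ∧ PA' = false ∧ PB = false ∧ PB' = false ∧ ((δ ∈ A ∧ δ ∈ B') ∨ (δ ∈ A' ∧ δ ∈ B))) ∨
          (PA = true ∧ δ ∈ B') ∨ (PB' = true ∧ δ ∈ A) ∨ (PA' = true ∧ δ ∈ B) ∨ (PB = true ∧ δ ∈ A')) then (1:ℤ) else 0))
  have h1 := Finset.sum_le_sum (fun γ (_ : γ ∈ (univ : Finset α)) => hbot γ)
  have h2 := Finset.sum_le_sum (fun γ (_ : γ ∈ (univ : Finset α)) => htop γ)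
  rw [hre] at h1
  rw [Finset.sum_sub_distrib]
  linarith

end AntitheticPureBroom

end Summit.CriticalPhenomena.PercolationContinuityZ3.Theorems
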